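import Mathlib
import Summits.Ventures.PercRepro2.A3PendantFree
import Summits.Ventures.PercRepro2.A3RootOnly

/-!
# Edge surgery: re-routing the edges of weight `0` changes no probability
(blind cell PercRepro2, night-1 g32; proofs/NIGHT1-G32.md §1)

Two incidence maps `ends, ends' : E → Sym2 V` that differ only on edges of weight `0` define the same
percolation measure on every connectivity event: a configuration of non-zero weight has every weight-`0`
edge closed (`eq_false_of_weight_ne_zero`), and two incidence maps that agree on the open edges of `ω`
have the same open subgraph (`openGraph_eq_of_agree_open`), hence the same connections and clusters.
`prob_eq_of_zero_off` is the transfer for an arbitrary pair of events that agree on such configurations,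
and the rest of the file transports the a₃-exploration vocabulary of p5 and night-1 (`mW`, `Ssig`, `Su`,
`SF`, `RootEdge.SFg`, `gamma`, `gamma0`, `LeafStep.mU`, `Do`, `btw`, `FMfun`, `A3Between`) across the
surgery (`*_surg`).  USE: a vertex carrying edges of weight `0` besides a leaf edge becomes a true leaf
after re-routing those edges to a loop elsewhere, so every leaf theorem (`hleaf : ∀ e, a₃ ∈ ends e →
e = f`) applies to it (A3PendantFreeZ.lean).  Standard axioms.
-/

namespace Summit.Ventures.PercRepro2

open UnionCluster CovForm

/-! ## The open subgraph only sees the incidence of the open edges -/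

section OpenGraph

variable {V : Type*} {E : Type*}

/-- Two incidence maps that agree on every open edge of `ω` have the same open adjacency. -/
lemma openAdj_iff_of_agree_open {ends ends' : E → Sym2 V} {ω : Config E}
    (h : ∀ e, ω e = true → ends e = ends' e) (u v : V) :
    OpenAdj ends ω u v ↔ OpenAdj ends' ω u v := by
  constructor
  · rintro ⟨e, he, hends⟩
    exact ⟨e, he, by rw [← h e he, hends]⟩
  · rintro ⟨e, he, hends⟩
    exact ⟨e, he, by rw [h e he, hends]⟩

/-- Two incidence maps that agree on every open edge of `ω` have the same open subgraph. -/
lemma openGraph_eq_of_agree_open {ends ends' : E → Sym2 V} {ω : Config E}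
    (h : ∀ e, ω e = true → ends e = ends' e) :
    openGraph ends ω = openGraph ends' ω := by
  unfold openGraph
  congr 1
  funext u v
  exact propext (openAdj_iff_of_agree_open h u v)

/-- Equal open subgraphs give the same connections. -/
lemma conn_iff_of_openGraph_eq {ends ends' : E → Sym2 V} {ω : Config E}
    (h : openGraph ends ω = openGraph ends' ω) (u v : V) :
    Conn ends ω u v ↔ Conn ends' ω u v := by
  unfold Conn
  rw [h]

/-- Equal open subgraphs give the same clusters. -/
lemma cluster_eq_of_openGraph_eq {ends ends' : E → Sym2 V} {ω : Config E}
    (h : openGraph ends ω = openGraph ends' ω) (v : V) :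
    cluster ends ω v = cluster ends' ω v := by
  ext u
  simp only [mem_cluster]
  exact conn_iff_of_openGraph_eq h v u

/-- Membership in `connEvent` across equal open subgraphs. -/
lemma mem_connEvent_iff_of_openGraph_eq {ends ends' : E → Sym2 V} {ω : Config E}
    (h : openGraph ends ω = openGraph ends' ω) (u v : V) :
    ω ∈ connEvent ends u v ↔ ω ∈ connEvent ends' u v := by
  simp only [mem_connEvent]
  exact conn_iff_of_openGraph_eq h u v

/-- Membership in `avoidAll` across equal open subgraphs. -/
lemma mem_avoidAll_iff_of_openGraph_eq {ends ends' : E → Sym2 V} {ω : Config E}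
    (h : openGraph ends ω = openGraph ends' ω) (s : V) (X : Finset V) :
    ω ∈ avoidAll ends s X ↔ ω ∈ avoidAll ends' s X := by
  simp only [avoidAll, Set.mem_setOf_eq, conn_iff_of_openGraph_eq h]

/-- Membership in `clusterEvent` across equal open subgraphs. -/
lemma mem_clusterEvent_iff_of_openGraph_eq {ends ends' : E → Sym2 V} {ω : Config E}
    (h : openGraph ends ω = openGraph ends' ω) (v : V) (S : Set V) :
    ω ∈ clusterEvent ends v S ↔ ω ∈ clusterEvent ends' v S := by
  simp only [mem_clusterEvent, cluster_eq_of_openGraph_eq h]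

/-- Membership in a fibre across equal open subgraphs. -/
lemma mem_fibre_iff_of_openGraph_eq {ends ends' : E → Sym2 V} {ω : Config E}
    (h : openGraph ends ω = openGraph ends' ω) (a₁ a₂ a₃ : V) (W : Finset V) :
    ω ∈ A3Fibre.fibre ends a₁ a₂ a₃ W ↔ ω ∈ A3Fibre.fibre ends' a₁ a₂ a₃ W := by
  simp only [A3Fibre.fibre, Set.mem_inter_iff, mem_avoidAll_iff_of_openGraph_eq h,
    mem_clusterEvent_iff_of_openGraph_eq h]

/-- Membership in `PDEvent` across equal open subgraphs. -/
lemma mem_PDEvent_iff_of_openGraph_eq {ends ends' : E → Sym2 V} {ω : Config E}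
    (h : openGraph ends ω = openGraph ends' ω) (a₁ a₂ a₃ : V) :
    ω ∈ PDEvent ends a₁ a₂ a₃ ↔ ω ∈ PDEvent ends' a₁ a₂ a₃ := by
  simp only [PDEvent, Dtilde, UnionCluster.inU, Set.mem_inter_iff, Set.mem_compl_iff,
    Set.mem_union, mem_connEvent, conn_iff_of_openGraph_eq h]

/-- Membership in `TEvent` across equal open subgraphs. -/
lemma mem_TEvent_iff_of_openGraph_eq {ends ends' : E → Sym2 V} {ω : Config E}
    (h : openGraph ends ω = openGraph ends' ω) (a₁ a₂ a₃ : V) :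
    ω ∈ TEvent ends a₁ a₂ a₃ ↔ ω ∈ TEvent ends' a₁ a₂ a₃ := by
  simp only [TEvent, Set.mem_inter_iff, Set.mem_compl_iff, mem_connEvent,
    conn_iff_of_openGraph_eq h]

end OpenGraph

/-! ## Configurations of non-zero weight have every weight-`0` edge closed -/

section Weight

variable {V : Type*} {E : Type*} [Fintype E] [DecidableEq E] {R : Type*} [CommRing R]

omit [DecidableEq E] in
/-- An open edge of weight `0` kills the weight. -/
lemma weight_eq_zero_of_open_of_zero (p : E → R) {ω : Config E} {e : E} (hp0 : p e = 0)
    (hω : ω e = true) : weight p ω = 0 := by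
  unfold weight
  apply Finset.prod_eq_zero (Finset.mem_univ e)
  rw [hω, hp0]
  simp [edgeFactor]

omit [DecidableEq E] in
/-- In a configuration of non-zero weight every edge of weight `0` is closed. -/
lemma eq_false_of_weight_ne_zero (p : E → R) {ω : Config E} {e : E} (hp0 : p e = 0)
    (hw : weight p ω ≠ 0) : ω e = false := by
  cases h : ω e
  · rfl
  · exact absurd (weight_eq_zero_of_open_of_zero p hp0 h) hw

/-- Two events that agree on every configuration of non-zero weight have the same probability. -/
lemma prob_eq_of_weight_imp (p : E → R) {A A' : Set (Config E)}
    (h : ∀ ω, weight p ω ≠ 0 → (ω ∈ A ↔ ω ∈ A')) : prob p A = prob p A' := by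
  unfold prob
  refine Finset.sum_congr rfl fun ω _ => ?_
  by_cases hw : weight p ω = 0
  · by_cases hA : ω ∈ A <;> by_cases hA' : ω ∈ A' <;> simp [hA, hA', hw]
  · by_cases hA : ω ∈ A
    · rw [Set.indicator_of_mem hA, Set.indicator_of_mem ((h ω hw).1 hA)]
    · rw [Set.indicator_of_notMem hA, Set.indicator_of_notMem (fun h' => hA ((h ω hw).2 h'))]

omit [DecidableEq E] in
/-- **Surgery**: if `ends` and `ends'` differ only on edges of weight `0`, every configuration of
non-zero weight has the same open subgraph under both. -/
lemma openGraph_eq_of_zero_off {p : E → R} {ends ends' : E → Sym2 V}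
    (hS : ∀ e, ends e ≠ ends' e → p e = 0) {ω : Config E} (hw : weight p ω ≠ 0) :
    openGraph ends ω = openGraph ends' ω := by
  apply openGraph_eq_of_agree_open
  intro e he
  by_contra hne
  have h0 := eq_false_of_weight_ne_zero p (hS e hne) hw
  rw [he] at h0
  exact Bool.noConfusion h0

/-- **Surgery transfer**: events that agree whenever the two open subgraphs agree have the same
probability when `ends` and `ends'` differ only on edges of weight `0`. -/
lemma prob_eq_of_zero_off {p : E → R} {ends ends' : E → Sym2 V}
    (hS : ∀ e, ends e ≠ ends' e → p e = 0) {A A' : Set (Config E)}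
    (h : ∀ ω, openGraph ends ω = openGraph ends' ω → (ω ∈ A ↔ ω ∈ A')) :
    prob p A = prob p A' :=
  prob_eq_of_weight_imp p fun ω hw => h ω (openGraph_eq_of_zero_off hS hw)

omit [Fintype E] in
/-- The surgery hypothesis survives pinning an edge on which the two incidence maps agree. -/
lemma zero_off_update {p : E → R} {ends ends' : E → Sym2 V}
    (hS : ∀ e, ends e ≠ ends' e → p e = 0) {f : E} (hf : ends f = ends' f) (q : R) :
    ∀ e, ends e ≠ ends' e → Function.update p f q e = 0 := by
  intro e he
  have hef : e ≠ f := fun h => he (h ▸ hf)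
  rw [Function.update_of_ne hef]
  exact hS e he

end Weight

/-! ## The a₃-exploration vocabulary across a surgery -/

namespace CovForm

namespace A3Fibre

section Surg

variable {V : Type*} {E : Type*} [Fintype V] [DecidableEq V] [Fintype E] [DecidableEq E]
  {R : Type*} [Field R] [LinearOrder R] {p : E → R} {ends ends' : E → Sym2 V}

omit [Fintype V] [DecidableEq V] [LinearOrder R] in
/-- `P(Q)` across a surgery. -/
lemma probQ_surg (hS : ∀ e, ends e ≠ ends' e → p e = 0) (a₁ a₂ : V) :
    prob p (avoidAll ends a₂ {a₁}) = prob p (avoidAll ends' a₂ {a₁}) :=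
  prob_eq_of_zero_off hS fun _ hG => mem_avoidAll_iff_of_openGraph_eq hG a₂ {a₁}

omit [Fintype V] [DecidableEq V] [LinearOrder R] in
/-- `P(Q ∩ {r ↔ x})` across a surgery. -/
lemma probQconn_surg (hS : ∀ e, ends e ≠ ends' e → p e = 0) (a₁ a₂ r x : V) :
    prob p (avoidAll ends a₂ {a₁} ∩ connEvent ends r x) =
      prob p (avoidAll ends' a₂ {a₁} ∩ connEvent ends' r x) :=
  prob_eq_of_zero_off hS fun _ hG => by
    simp only [Set.mem_inter_iff, mem_avoidAll_iff_of_openGraph_eq hG,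
      mem_connEvent_iff_of_openGraph_eq hG]

omit [Fintype V] [DecidableEq V] [LinearOrder R] in
/-- `P(PD)` across a surgery. -/
lemma probPD_surg (hS : ∀ e, ends e ≠ ends' e → p e = 0) (a₁ a₂ a₃ : V) :
    prob p (PDEvent ends a₁ a₂ a₃) = prob p (PDEvent ends' a₁ a₂ a₃) :=
  prob_eq_of_zero_off hS fun _ hG => mem_PDEvent_iff_of_openGraph_eq hG a₁ a₂ a₃

omit [Fintype V] [DecidableEq V] [LinearOrder R] in
/-- `P(PD ∩ {r ↔ x})` across a surgery. -/
lemma probPDconn_surg (hS : ∀ e, ends e ≠ ends' e → p e = 0) (a₁ a₂ a₃ r x : V) :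
    prob p (PDEvent ends a₁ a₂ a₃ ∩ connEvent ends r x) =
      prob p (PDEvent ends' a₁ a₂ a₃ ∩ connEvent ends' r x) :=
  prob_eq_of_zero_off hS fun _ hG => by
    simp only [Set.mem_inter_iff, mem_PDEvent_iff_of_openGraph_eq hG,
      mem_connEvent_iff_of_openGraph_eq hG]

omit [Fintype V] [DecidableEq V] [LinearOrder R] in
/-- `m_W` across a surgery. -/
lemma mW_surg (hS : ∀ e, ends e ≠ ends' e → p e = 0) (a₁ a₂ a₃ : V) (W : Finset V) :
    mW p ends a₁ a₂ a₃ W = mW p ends' a₁ a₂ a₃ W :=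
  prob_eq_of_zero_off hS fun _ hG => mem_fibre_iff_of_openGraph_eq hG a₁ a₂ a₃ W

omit [Fintype V] [DecidableEq V] [LinearOrder R] in
/-- The fibre–connection masses across a surgery. -/
lemma prob_fibre_conn_surg (hS : ∀ e, ends e ≠ ends' e → p e = 0) (a₁ a₂ a₃ r x : V)
    (W : Finset V) :
    prob p (fibre ends a₁ a₂ a₃ W ∩ connEvent ends r x) =
      prob p (fibre ends' a₁ a₂ a₃ W ∩ connEvent ends' r x) :=
  prob_eq_of_zero_off hS fun _ hG => by
    simp only [Set.mem_inter_iff, mem_fibre_iff_of_openGraph_eq hG,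
      mem_connEvent_iff_of_openGraph_eq hG]

omit [Fintype V] [DecidableEq V] [LinearOrder R] in
/-- `Ssig` across a surgery. -/
lemma Ssig_surg (hS : ∀ e, ends e ≠ ends' e → p e = 0) (a₁ a₂ a₃ x : V) (W : Finset V) :
    Ssig p ends a₁ a₂ a₃ x W = Ssig p ends' a₁ a₂ a₃ x W := by
  unfold Ssig
  rw [prob_fibre_conn_surg hS, prob_fibre_conn_surg hS]

omit [Fintype V] [DecidableEq V] [LinearOrder R] in
/-- `Su` across a surgery. -/
lemma Su_surg (hS : ∀ e, ends e ≠ ends' e → p e = 0) (a₁ a₂ a₃ x : V) (W : Finset V) :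
    Su p ends a₁ a₂ a₃ x W = Su p ends' a₁ a₂ a₃ x W := by
  unfold Su
  rw [prob_fibre_conn_surg hS, prob_fibre_conn_surg hS]

omit [Fintype V] [DecidableEq V] [LinearOrder R] in
/-- `D_o` across a surgery. -/
lemma Do_surg (hS : ∀ e, ends e ≠ ends' e → p e = 0) (o a₁ a₂ a₃ : V) :
    Do p ends o a₁ a₂ a₃ = Do p ends' o a₁ a₂ a₃ := by
  unfold Do
  rw [probPDconn_surg hS, probPDconn_surg hS]

omit [Fintype V] [DecidableEq V] [LinearOrder R] in
/-- `m_x = P(Q, x ∈ U)` across a surgery. -/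
lemma mU_surg (hS : ∀ e, ends e ≠ ends' e → p e = 0) (a₁ a₂ x : V) :
    LeafStep.mU p ends a₁ a₂ x = LeafStep.mU p ends' a₁ a₂ x := by
  unfold LeafStep.mU
  rw [probQconn_surg hS, probQconn_surg hS]

omit [Fintype V] [DecidableEq V] [LinearOrder R] in
/-- `γ` across a surgery. -/
lemma gamma_surg (hS : ∀ e, ends e ≠ ends' e → p e = 0) (o a₁ a₂ a₃ : V) :
    gamma p ends o a₁ a₂ a₃ = gamma p ends' o a₁ a₂ a₃ := by
  unfold gamma
  rw [Do_surg hS, probPD_surg hS]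

omit [Fintype V] [DecidableEq V] [LinearOrder R] in
/-- `γ₀` across a surgery. -/
lemma gamma0_surg (hS : ∀ e, ends e ≠ ends' e → p e = 0) (o a₁ a₂ : V) :
    gamma0 p ends o a₁ a₂ = gamma0 p ends' o a₁ a₂ := by
  unfold gamma0
  rw [mU_surg hS, probQ_surg hS]

omit [Fintype V] [LinearOrder R] in
/-- `SFg` across a surgery (any centring). -/
lemma SFg_surg (hS : ∀ e, ends e ≠ ends' e → p e = 0) (o a₁ a₂ a₃ : V) (γ : R) (W : Finset V) :
    RootEdge.SFg p ends o a₁ a₂ a₃ γ W = RootEdge.SFg p ends' o a₁ a₂ a₃ γ W := by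
  unfold RootEdge.SFg
  rw [Ssig_surg hS, Su_surg hS, mW_surg hS]

omit [Fintype V] [LinearOrder R] in
/-- `SF` across a surgery. -/
lemma SF_surg (hS : ∀ e, ends e ≠ ends' e → p e = 0) (o a₁ a₂ a₃ : V) (W : Finset V) :
    SF p ends o a₁ a₂ a₃ W = SF p ends' o a₁ a₂ a₃ W := by
  unfold SF
  rw [Ssig_surg hS, Su_surg hS, mW_surg hS, gamma_surg hS]

omit [LinearOrder R] in
/-- **`btw` across a surgery.** -/
lemma btw_surg (hS : ∀ e, ends e ≠ ends' e → p e = 0) (o a₁ a₂ a₃ b : V) :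
    btw p ends o a₁ a₂ a₃ b = btw p ends' o a₁ a₂ a₃ b := by
  unfold btw
  simp only [Ssig_surg hS, Su_surg hS, mW_surg hS, SF_surg hS, probQ_surg hS, probPD_surg hS]

omit [LinearOrder R] in
/-- **`FMfun` across a surgery.** -/
lemma FMfun_surg (hS : ∀ e, ends e ≠ ends' e → p e = 0) (o a₁ a₂ v b : V) :
    FMfun p ends o a₁ a₂ v b = FMfun p ends' o a₁ a₂ v b := by
  unfold FMfun
  simp only [Ssig_surg hS, Su_surg hS, mW_surg hS, SFg_surg hS, gamma0_surg hS, probQ_surg hS,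
    probPD_surg hS, mU_surg hS]

/-- **(MEANS-a₃) across a surgery.** -/
lemma A3Between_surg (hS : ∀ e, ends e ≠ ends' e → p e = 0) (o a₁ a₂ a₃ b : V) :
    A3Between p ends o a₁ a₂ a₃ b ↔ A3Between p ends' o a₁ a₂ a₃ b := by
  unfold A3Between
  rw [btw_surg hS]

end Surg

end A3Fibre

/-! ## (HCOV) across a surgery -/

section HCovSurg

variable {V : Type*} {E : Type*} [Fintype V] [DecidableEq V] [Fintype E] [DecidableEq E]
  {R : Type*} [Field R] [LinearOrder R] {p : E → R} {ends ends' : E → Sym2 V}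

omit [Fintype V] [DecidableEq V] [LinearOrder R] in
/-- `P(Q ∩ {r ↔ x} ∩ {r' ↔ y})` across a surgery. -/
lemma probQconn2_surg (hS : ∀ e, ends e ≠ ends' e → p e = 0) (a₁ a₂ r x r' y : V) :
    prob p (avoidAll ends a₂ {a₁} ∩ (connEvent ends r x ∩ connEvent ends r' y)) =
      prob p (avoidAll ends' a₂ {a₁} ∩ (connEvent ends' r x ∩ connEvent ends' r' y)) :=
  prob_eq_of_zero_off hS fun _ hG => by
    simp only [Set.mem_inter_iff, mem_avoidAll_iff_of_openGraph_eq hG,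
      mem_connEvent_iff_of_openGraph_eq hG]

omit [Fintype V] [DecidableEq V] [LinearOrder R] in
/-- `P(T ∩ {r ↔ x})` across a surgery. -/
lemma probTconn_surg (hS : ∀ e, ends e ≠ ends' e → p e = 0) (a₁ a₂ a₃ r x : V) :
    prob p (TEvent ends a₁ a₂ a₃ ∩ connEvent ends r x) =
      prob p (TEvent ends' a₁ a₂ a₃ ∩ connEvent ends' r x) :=
  prob_eq_of_zero_off hS fun _ hG => by
    simp only [Set.mem_inter_iff, mem_TEvent_iff_of_openGraph_eq hG,
      mem_connEvent_iff_of_openGraph_eq hG]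

omit [Fintype V] [DecidableEq V] [LinearOrder R] in
/-- `P(T ∩ {r ↔ x} ∩ {r' ↔ y})` across a surgery. -/
lemma probTconn2_surg (hS : ∀ e, ends e ≠ ends' e → p e = 0) (a₁ a₂ a₃ r x r' y : V) :
    prob p (TEvent ends a₁ a₂ a₃ ∩ (connEvent ends r x ∩ connEvent ends r' y)) =
      prob p (TEvent ends' a₁ a₂ a₃ ∩ (connEvent ends' r x ∩ connEvent ends' r' y)) :=
  prob_eq_of_zero_off hS fun _ hG => by
    simp only [Set.mem_inter_iff, mem_TEvent_iff_of_openGraph_eq hG,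
      mem_connEvent_iff_of_openGraph_eq hG]

omit [Fintype V] [DecidableEq V] [LinearOrder R] in
/-- `P(T)` across a surgery. -/
lemma probT_surg (hS : ∀ e, ends e ≠ ends' e → p e = 0) (a₁ a₂ a₃ : V) :
    prob p (TEvent ends a₁ a₂ a₃) = prob p (TEvent ends' a₁ a₂ a₃) :=
  prob_eq_of_zero_off hS fun _ hG => mem_TEvent_iff_of_openGraph_eq hG a₁ a₂ a₃

omit [Fintype V] [DecidableEq V] [LinearOrder R] in
/-- `P(PD ∩ {r ↔ x} ∩ {r' ↔ y})` across a surgery. -/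
lemma probPDconn2_surg (hS : ∀ e, ends e ≠ ends' e → p e = 0) (a₁ a₂ a₃ r x r' y : V) :
    prob p (PDEvent ends a₁ a₂ a₃ ∩ (connEvent ends r x ∩ connEvent ends r' y)) =
      prob p (PDEvent ends' a₁ a₂ a₃ ∩ (connEvent ends' r x ∩ connEvent ends' r' y)) :=
  prob_eq_of_zero_off hS fun _ hG => by
    simp only [Set.mem_inter_iff, mem_PDEvent_iff_of_openGraph_eq hG,
      mem_connEvent_iff_of_openGraph_eq hG]

omit [Fintype V] [DecidableEq V] [LinearOrder R] in
/-- `P({r ↔ x})` across a surgery. -/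
lemma probConn_surg (hS : ∀ e, ends e ≠ ends' e → p e = 0) (r x : V) :
    prob p (connEvent ends r x) = prob p (connEvent ends' r x) :=
  prob_eq_of_zero_off hS fun _ hG => mem_connEvent_iff_of_openGraph_eq hG r x

omit [Fintype V] [DecidableEq V] [LinearOrder R] in
/-- **`Gc` across a surgery.** -/
lemma Gc_surg (hS : ∀ e, ends e ≠ ends' e → p e = 0) (o a₁ a₂ a₃ b : V) :
    Gc p ends o a₁ a₂ a₃ b = Gc p ends' o a₁ a₂ a₃ b := by
  unfold Gc EQbo EQb3 EQb3o DEF EQo EQ3 EQ3o PDb PDbo Do gap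
  simp only [A3Fibre.probQ_surg hS, A3Fibre.probPD_surg hS, A3Fibre.probQconn_surg hS,
    probQconn2_surg hS, probTconn_surg hS, probTconn2_surg hS, probT_surg hS,
    A3Fibre.probPDconn_surg hS, probPDconn2_surg hS, probConn_surg hS]

omit [Fintype V] [DecidableEq V] in
/-- **(HCOV) across a surgery.** -/
lemma HCov_surg (hS : ∀ e, ends e ≠ ends' e → p e = 0) (o a₁ a₂ a₃ b : V) :
    HCov p ends o a₁ a₂ a₃ b ↔ HCov p ends' o a₁ a₂ a₃ b := by
  unfold HCov
  rw [Gc_surg hS]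

end HCovSurg

end CovForm

end Summit.Ventures.PercRepro2
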